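import Literature.AlgebraicGeometry.HodgeTheory.HodgeStructureOfHodgeModel
import Literature.AlgebraicGeometry.HodgeTheory.ComplexConjugationHolds
import Literature.AlgebraicGeometry.HodgeTheory.HodgeFiltrationModelsReductionProofs
import HarnessLib

/-!
# Hodge symmetry `h^{p,q}(X) = h^{q,p}(X)` for the Hodge numbers read in ANY Hodge model — PROVED

Layer `Literature/AlgebraicGeometry/HodgeTheory`.  A kernel lemma (no named fact) assembled from
theorems of the tree, for the cell `hodge-kum4` (ladder HodgeAV, rung H3; cell home
run/shared/lean/pub/hodge-kum4/, seat p2's request of 2026-08-25T19:33Z: the Hodge-index record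
`Voisin2002_hodgeIndex_hodgeRiemann_middle` sums `Σ_{a,b} (-1)^a h^{a,b}` while the `χ_y`-record
`GoettscheSoergel1993_chiY_kum4Type.signatureSum_eq` sums `Σ_{p,q} (-1)^q h^{p,q}`; the two agree by
Hodge symmetry).  Several records of this layer read "`h^{p,q}(X)`" as
`Module.finrank ℂ (A.hodgePQ (p + q) p q)` for an ARBITRARY Hodge model `A : HodgeModel n X`
(`Hyperkaehler/GeneralizedKummerFourHodgeNumbers`, `HodgeTheory/HodgeIndexHodgeRiemannMiddle`);
this file proves, for `X` smooth projective, that this number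

* does not depend on the model (the tree's `HodgeModel.finrank_hodgePQ_eq_of_hodgeModel` of
  `Motives/FiberNetSmoothFibres`, from `hodgePQ_independent_of_hodgeModel_holds`; re-proved privately
  below to keep this file's imports elementary), and
* is symmetric in `(p, q)` (`HodgeModel.finrank_hodgePQ_symm`): pass to a REAL model
  (`exists_isReal_hodgeModel_holds`), which is Hodge symmetric (`HodgeModel.IsReal.isHodgeSymmetric`,
  Voisin I Cor. 6.12 `conj H^{p,q} = H^{q,p}`), where the number is the Hodge number of the
  `ℚ`-Hodge structure `A.hodgeStructure` (`HodgeModel.piece_eq_ratPiece`) and Hodge numbers of a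
  `ℚ`-Hodge structure are symmetric (`Motives.HodgeStructure.hodgeNumber_symm_holds`: `conj` is a
  conjugate-linear bijection `V^{p,q} ≃ V^{q,p}`).

Source of the statement: C. Voisin, *Hodge Theory and Complex Algebraic Geometry I* (2002), §6.1.3
Cor. 6.12 ("we have `conj H^{p,q} = H^{q,p}`") and Cor. 6.13 / §7.1.1 (the Hodge numbers
`h^{p,q} = dim H^{p,q}` satisfy `h^{p,q} = h^{q,p}`).  The abelian-variety instance
`HodgeModel.finrank_typePiece_symm` (`AbelianVarietyHodgeNumbers`) reads the symmetry off the
formula `C(g,p)C(g,q)`; here it is proved for every smooth projective `X`.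

## Content (all PROVED; no new definition, no named fact)

* `HodgeModel.finrank_hodgePQ_symm_of_isHodgeSymmetric` — symmetry in a Hodge-symmetric model;
* `HodgeModel.finrank_hodgePQ_symm` — symmetry in any model (`p + q = k`);
* `HodgeModel.sum_sum_neg_one_pow_fst_eq_snd` — the bookkeeping corollary
  `Σ_{a,b ≤ N} (-1)^a h^{a,b} = Σ_{p,q ≤ N} (-1)^q h^{p,q}` (reindex `(a,b) ↦ (b,a)` and apply symmetry),
  the bridge between the two records named above.
-/

noncomputable section

open Literature.AlgebraicTopology.SingularHomology

namespace Literature.AlgebraicGeometry.HodgeTheory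

namespace HodgeModel

variable {n : ℕ} {X : Motives.SchemeOver ℂ}

/-- `dim H^{p,q}` does not depend on the Hodge model (smooth projective `X`): the pieces `H^{p,q}`
of two models, pulled back to `Hᵏ(X(ℂ); ℂ)` along the (bijective) comparison maps, are the same
subspace (`hodgePQ_independent_of_hodgeModel_holds`), and a linear isomorphism preserves `finrank`.
This is the tree's `HodgeModel.finrank_hodgePQ_eq_of_hodgeModel` (`Motives/FiberNetSmoothFibres`),
re-proved here in four lines PRIVATELY so that this elementary file does not import the library of
nets and Ehresmann fibrations. [cite: VoisinHodgeI2002, Prop. 6.11 and §7.3.2] -/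
private theorem finrank_hodgePQ_eq_of_hodgeModel_aux (hX : Motives.IsSmoothProjective n X)
    (A B : HodgeModel n X) (k p q : ℕ) :
    Module.finrank ℂ (A.hodgePQ k p q) = Module.finrank ℂ (B.hodgePQ k p q) := by
  have hAB : (A.hodgePQ k p q).comap (A.pullbackEquiv k).toLinearMap =
      (B.hodgePQ k p q).comap (B.pullbackEquiv k).toLinearMap := by
    ext c
    simp only [Submodule.mem_comap, LinearEquiv.coe_coe, pullbackEquiv_apply]
    exact hodgePQ_independent_of_hodgeModel_holds.mem_hodgePQ_iff hX A B
  have hA : Module.finrank ℂ ((A.hodgePQ k p q).comap (A.pullbackEquiv k).toLinearMap) =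
      Module.finrank ℂ (A.hodgePQ k p q) := by
    rw [Submodule.comap_equiv_eq_map_symm, LinearEquiv.finrank_map_eq]
  have hB : Module.finrank ℂ ((B.hodgePQ k p q).comap (B.pullbackEquiv k).toLinearMap) =
      Module.finrank ℂ (B.hodgePQ k p q) := by
    rw [Submodule.comap_equiv_eq_map_symm, LinearEquiv.finrank_map_eq]
  rw [← hA, ← hB, hAB]

/-- **Hodge symmetry in a Hodge-symmetric model**: `dim H^{p,q} = dim H^{q,p}` (`p + q = k`).  In such
a model `dim H^{p,q}` is the Hodge number `h^{p,q}` of the `ℚ`-Hodge structure `A.hodgeStructure`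
on `Hᵏ(X(ℂ); ℚ)` (`piece_eq_ratPiece`, transport along `Θ_A`), and `h^{p,q} = h^{q,p}` for every
`ℚ`-Hodge structure (`Motives.HodgeStructure.hodgeNumber_symm_holds`).
[cite: VoisinHodgeI2002, §6.1.3 Cor. 6.12 and §7.1.1] -/
theorem finrank_hodgePQ_symm_of_isHodgeSymmetric (hX : Motives.IsSmoothProjective n X)
    (A : HodgeModel n X) (hA : A.IsHodgeSymmetric) {k p q : ℕ} (hpq : p + q = k) :
    Module.finrank ℂ (A.hodgePQ k p q) = Module.finrank ℂ (A.hodgePQ k q p) := by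
  have hrat : ∀ p' q' : ℕ, Module.finrank ℂ (A.ratPiece hX k p' q') =
      Module.finrank ℂ (A.hodgePQ k p' q') := fun p' q' ↦ by
    rw [HodgeModel.ratPiece, Submodule.comap_equiv_eq_map_symm, LinearEquiv.finrank_map_eq]
  have h := Motives.HodgeStructure.hodgeNumber_symm_holds (A.hodgeStructure hX hA k) p q
  unfold Motives.HodgeStructure.hodgeNumber at h
  rw [A.piece_eq_ratPiece hX hA hpq, A.piece_eq_ratPiece hX hA (by omega : q + p = k)] at h
  rw [← hrat, ← hrat]
  exact h

/-- **Hodge symmetry `h^{p,q}(X) = h^{q,p}(X)` in ANY Hodge model of a smooth projective `X`**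
(`p + q = k`): reduce to a real, hence Hodge-symmetric, model (`exists_isReal_hodgeModel_holds`,
`IsReal.isHodgeSymmetric`) by model independence of `dim H^{p,q}` (`hodgePQ_independent_of_hodgeModel_holds`).
Voisin I Cor. 6.12: "we have `conj H^{p,q} = H^{q,p}`", whence `h^{p,q} = h^{q,p}`.
[cite: VoisinHodgeI2002, §6.1.3 Cor. 6.12 and §7.1.1] -/
theorem finrank_hodgePQ_symm (hX : Motives.IsSmoothProjective n X) (A : HodgeModel n X)
    {k p q : ℕ} (hpq : p + q = k) :
    Module.finrank ℂ (A.hodgePQ k p q) = Module.finrank ℂ (A.hodgePQ k q p) := by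
  obtain ⟨B, hB⟩ := exists_isReal_hodgeModel_holds.exists_isHodgeSymmetric hX
  rw [finrank_hodgePQ_eq_of_hodgeModel_aux hX A B, finrank_hodgePQ_eq_of_hodgeModel_aux hX A B]
  exact finrank_hodgePQ_symm_of_isHodgeSymmetric hX B hB hpq

/-- **`Σ_{a,b ≤ N} (-1)^a h^{a,b}(X) = Σ_{p,q ≤ N} (-1)^q h^{p,q}(X)`** for any Hodge model of a smooth
projective `X` and any summation range `Fin (N + 1)`: reindex `(a, b) ↦ (b, a)` and use Hodge
symmetry `h^{b,a} = h^{a,b}` (`finrank_hodgePQ_symm`).  This is the bridge between the Hodge-index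
shape `Σ (-1)^a h^{a,b}` (Voisin I Thm. 6.33, record `Voisin2002_hodgeIndex_hodgeRiemann_middle`) and
the `χ_y`-shape `Σ (-1)^q h^{p,q}` (record `GoettscheSoergel1993_chiY_kum4Type.signatureSum_eq`).
[cite: VoisinHodgeI2002, §6.1.3 Cor. 6.12 and §6.3.2 Thm. 6.33] -/
theorem sum_sum_neg_one_pow_fst_eq_snd (hX : Motives.IsSmoothProjective n X) (A : HodgeModel n X)
    (N : ℕ) :
    (∑ a : Fin (N + 1), ∑ b : Fin (N + 1),
        (-1 : ℤ) ^ (a : ℕ) * (Module.finrank ℂ (A.hodgePQ ((a : ℕ) + b) a b) : ℤ)) =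
      ∑ p : Fin (N + 1), ∑ q : Fin (N + 1),
        (-1 : ℤ) ^ (q : ℕ) * (Module.finrank ℂ (A.hodgePQ ((p : ℕ) + q) p q) : ℤ) := by
  rw [Finset.sum_comm]
  refine Finset.sum_congr rfl fun p _ ↦ Finset.sum_congr rfl fun q _ ↦ ?_
  rw [A.finrank_hodgePQ_symm hX (k := (q : ℕ) + p) (p := q) (q := p) rfl, Nat.add_comm (q : ℕ) (p : ℕ)]

end HodgeModel

end Literature.AlgebraicGeometry.HodgeTheory

end
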